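import Literature.Computability.Complexity.HiraharaSpec
import Literature.Computability.Complexity.CodeFPBudgets
import Literature.Computability.Complexity.CodeFPLists
import HarnessLib

/-!
# The machine of Hirahara's reduction, I: the preprocessing decisions on codes

Topic `Computability/Complexity`. First part of the polynomial-time string function computing
`HiraharaRed.redOut` (`HiraharaSpec.lean`) on codes, written in the typed `CodeFP` algebra
(`CodeFP.lean`, `CodeFPArith.lean`, `CodeFPBudgets.lean`, `CodeFPLists.lean`) on the instance tuples
`TO = ℕ × List (List (List ℕ)) × List ℕ × ℕ` of `CSPToCMMSAMachine.lean` (`toE`): the list-level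
mirrors of the degenerate-case tests of `redOut` — well-formedness of the weight list, an empty
formula, total weight `≤ θ`, no kept formula, `θ = 0`, smallness `Δ(n) < c`, and the brute-force
test — each proved equal to the specification on `I₀.toTuple` and computed on codes.

## References

* S. Hirahara, *NP-hardness of learning programs and partial MCSP*, ECCC TR22-119, proof of
  Thm. 8.5 (`MCSP*` case) [Hirahara2022PartialMCSP].
* S. Arora, B. Barak, *Computational Complexity: A Modern Approach*, CUP 2009, §1.2–1.3.
-/

namespace Literature.Computability.Complexity

open _root_.Computability Polynomial
open Literature.Computability.MetaComplexity (MonotoneDNF sqrtLog CMMSAInstance)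
open CSPToCMMSAMachine (TO toE)
open CodeFP

namespace HiraharaMachine

/-! ### Small generic combinators -/

/-- **Sum of a raw list of unary numerals** (unary). [cite: AroraBarak2009, §1.3 (bounded loops)] -/
theorem unSum : CodeFP (rawE unE) unE List.sum := by
  have h := foldl₀ (eα := unE) (step := fun (a : ℕ) (k : ℕ) => k + a) (b₀ := 0)
    (unAdd.comp ((snd unE unE).pair (fst unE unE))) X (fun l₁ l₂ => by
      have hfold : ∀ (l : List ℕ) (k : ℕ), l.foldl (fun k a => k + a) k = k + l.sum := by
        intro l; induction l with
        | nil => intro k; simp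
        | cons a l ih => intro k; rw [List.foldl_cons, ih]; simp [add_assoc]
      rw [hfold, zero_add, length_unE, eval_X, length_rawE]
      have hmap : ∀ l : List ℕ, (l.map fun a => 2 * (unE a).length + 2) = l.map fun a => 2 * a + 2 := by
        intro l; simp [length_unE]
      have : ∀ l : List ℕ, l.sum ≤ (l.map fun a => 2 * a + 2).sum := by
        intro l; induction l with
        | nil => simp
        | cons a l ih => simp only [List.sum_cons, List.map_cons]; omega
      rw [hmap]
      exact (this l₁).trans (List.Sublist.sum_le_sum ((List.sublist_append_left l₁ l₂).map _) fun _ _ => Nat.zero_le _))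
  exact h.congr fun l => by
    have hfold : ∀ (l : List ℕ) (k : ℕ), l.foldl (fun k a => k + a) k = k + l.sum := by
      intro l; induction l with
      | nil => intro k; simp
      | cons a l ih => intro k; rw [List.foldl_cons, ih]; simp [add_assoc]
    rw [hfold, zero_add]

/-! ### The tuple fields -/

/-- The weight of a variable read off the tuple (`0` out of range). [folklore] -/
def wT (t : TO) (v : ℕ) : ℕ := t.2.2.1.getD v 0

/-- On an instance tuple, `wT` is `CMMSAInstance.w`. [folklore] -/
@[simp] theorem wT_toTuple (I₀ : CMMSAInstance) (v : ℕ) : wT I₀.toTuple v = I₀.w v := rfl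

/-- The reduced formula (zero-weight literals deleted), on tuples. [cite: Hirahara2022PartialMCSP, proof of Thm. 8.5] -/
def redFormulaT (t : TO) (φ : MonotoneDNF) : MonotoneDNF := φ.map fun term => term.filter fun v => decide (wT t v ≠ 0)

/-- On an instance tuple, `redFormulaT` is `Pre.redFormula`. [folklore] -/
@[simp] theorem redFormulaT_toTuple (I₀ : CMMSAInstance) (φ : MonotoneDNF) :
    redFormulaT I₀.toTuple φ = HiraharaRed.Pre.redFormula I₀ φ := rfl

/-- The kept formulas, on tuples. [cite: Hirahara2022PartialMCSP, proof of Thm. 8.5] -/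
def keptT (t : TO) : List MonotoneDNF := (t.2.1.map (redFormulaT t)).filter fun φ => decide ([] ∉ φ)

/-- On an instance tuple, `keptT` is `Pre.kept`. [folklore] -/
@[simp] theorem keptT_toTuple (I₀ : CMMSAInstance) : keptT I₀.toTuple = HiraharaRed.Pre.kept I₀ := rfl

/-! ### Codes of the fields -/

/-- The input code `(tuple, coins)`. [folklore] -/
abbrev inE : TO × List Bool → List Bool := pairE toE strE

/-- The weight list, raw. [folklore] -/
theorem codeFP_wt : CodeFP toE (rawE unE) (fun t => t.2.2.1) :=
  (rawOfList unE).comp (snd _ _).snd'.fst'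

/-- The formula list, raw. [folklore] -/
theorem codeFP_formulas : CodeFP toE (rawE (listE (listE natE))) (fun t => t.2.1) :=
  (rawOfList _).comp (snd _ _).fst'

/-- `n` (binary). [folklore] -/
theorem codeFP_n : CodeFP toE natE (fun t => t.1) := fst _ _

/-- `θ` (binary). [folklore] -/
theorem codeFP_θ : CodeFP toE natE (fun t => t.2.2.2) := (snd _ _).snd'.snd'

/-- A weight lookup `(t, v) ↦ wT t v` (`v` binary). [folklore] -/
theorem codeFP_wT : CodeFP (pairE toE natE) unE (fun p => wT p.1 p.2) :=
  (rawGetD unE (d := 0) rfl).comp ((codeFP_wt.comp (fst _ _)).pair (snd _ _))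

/-- The raw code of a formula: raw terms of raw literals. [folklore] -/
abbrev fE : MonotoneDNF → List Bool := rawE (rawE natE)

/-- Re-reading a `listE`-coded formula as raw terms of raw literals. [folklore] -/
theorem codeFP_fRaw : CodeFP (listE (listE natE)) fE id :=
  ((map₀ (rawOfList natE)).comp (rawOfList (listE natE))).congr fun φ => by simp

/-- The formulas, as raw codes. [folklore] -/
theorem codeFP_formulasRaw : CodeFP toE (rawE fE) (fun t => t.2.1) :=
  ((map₀ codeFP_fRaw).comp codeFP_formulas).congr fun t => by simp


/-! ### The decisions -/

/-- Well-formedness on tuples: the weight list has length `n` and every literal is `< n`. [folklore] -/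
def wfT (t : TO) : Bool :=
  decide (t.2.2.1.length = t.1) && t.2.1.all fun φ => φ.all fun term => term.all fun v => decide (v < t.1)

/-- `wfT` decides `WellFormed`. [folklore] -/
theorem wfT_toTuple (I₀ : CMMSAInstance) : wfT I₀.toTuple = true ↔ I₀.WellFormed := by
  unfold wfT CMMSAInstance.WellFormed MonotoneDNF.IsOver
  simp [CMMSAInstance.toTuple, List.all_eq_true]

/-- Well-formedness on codes. [folklore] -/
theorem codeFP_wfT : CodeFP toE bitE wfT := by
  have hlen : CodeFP toE bitE (fun t => decide (t.2.2.1.length = t.1)) :=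
    natEq.comp (((natLength unE).comp codeFP_wt).pair codeFP_n)
  -- literal test with context `n`
  have hlit : CodeFP (pairE natE natE) bitE (fun q => decide (q.2 < q.1)) := natLt.comp ((snd _ _).pair (fst _ _))
  have hterm : CodeFP (pairE natE (rawE natE)) bitE (fun q => q.2.all fun v => decide (v < q.1)) := all hlit
  have hform : CodeFP (pairE natE fE) bitE (fun q => q.2.all fun term => term.all fun v => decide (v < q.1)) := all hterm
  have hall : CodeFP toE bitE (fun t => t.2.1.all fun φ => φ.all fun term => term.all fun v => decide (v < t.1)) :=
    (all hform).comp (codeFP_n.pair codeFP_formulasRaw)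
  exact (hlen.and hall).congr fun t => rfl

/-- Test 1: ill-formed. [folklore] -/
def d1 (t : TO) : Bool := !wfT t

/-- Test 1 on codes. [folklore] -/
theorem codeFP_d1 : CodeFP toE bitE d1 := codeFP_wfT.not

/-- Test 2: some formula is empty. [folklore] -/
def d2 (t : TO) : Bool := t.2.1.any List.isEmpty

/-- Test 2 on codes. [folklore] -/
theorem codeFP_d2 : CodeFP toE bitE d2 :=
  ((any (σ := TO) (eσ := toE) ((rawIsEmpty (listE natE)).comp ((rawOfList (listE natE)).comp (snd toE (listE (listE natE)))))).comp
    ((CodeFP.id toE).pair codeFP_formulas)).congr fun t => by simp [d2]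

/-- Test 3: total weight (the sum of the list) at most `θ`. [folklore] -/
def d3 (t : TO) : Bool := decide (t.2.2.1.sum ≤ t.2.2.2)

/-- Test 3 on codes. [folklore] -/
theorem codeFP_d3 : CodeFP toE bitE d3 :=
  unLeNat.comp ((unSum.comp codeFP_wt).pair codeFP_θ)

/-- The literal test `w(v) ≠ 0` with the tuple as context. [folklore] -/
theorem codeFP_wNeZero : CodeFP (pairE toE natE) bitE (fun p => decide (wT p.1 p.2 ≠ 0)) :=
  (unLeNat.comp (codeFP_wT.pair (const _ 0))).not.congr fun p => by
    simp only [decide_not, Nat.le_zero]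

/-- Reducing a formula, with the tuple as context. [cite: Hirahara2022PartialMCSP, proof of Thm. 8.5] -/
theorem codeFP_redFormulaT : CodeFP (pairE toE fE) fE (fun p => redFormulaT p.1 p.2) := by
  have hterm : CodeFP (pairE toE (rawE natE)) (rawE natE) (fun q => q.2.filter fun v => decide (wT q.1 v ≠ 0)) :=
    CodeFP.filter codeFP_wNeZero
  exact (map (σ := TO) (eσ := toE) hterm).congr fun p => rfl

/-- The kept formulas on codes. [cite: Hirahara2022PartialMCSP, proof of Thm. 8.5] -/
theorem codeFP_keptT : CodeFP toE (rawE fE) keptT := by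
  have hred : CodeFP toE (rawE fE) (fun t => t.2.1.map (redFormulaT t)) :=
    ((map codeFP_redFormulaT).comp ((CodeFP.id toE).pair codeFP_formulasRaw)).congr fun t => rfl
  have hnil : CodeFP (pairE toE fE) bitE (fun q => decide (([] : List ℕ) ∉ q.2)) :=
    ((any (σ := TO) (eσ := toE) ((rawIsEmpty natE).comp (snd toE (rawE natE)))).comp
      ((fst _ _).pair (snd _ _))).not.congr fun q => by
        rw [Bool.eq_iff_iff]
        simp only [Bool.not_eq_true', List.any_eq_false, List.isEmpty_iff, decide_eq_true_eq]
        exact ⟨fun h hm => h [] hm rfl, fun h x hx hx0 => h (hx0 ▸ hx)⟩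
  exact ((CodeFP.filter hnil).comp ((CodeFP.id toE).pair hred)).congr fun t => rfl

/-- Test 4: no kept formula. [folklore] -/
def d4 (t : TO) : Bool := (keptT t).isEmpty

/-- Test 4 on codes. [folklore] -/
theorem codeFP_d4 : CodeFP toE bitE d4 := (rawIsEmpty fE).comp codeFP_keptT

/-- Test 5: `θ = 0`. [folklore] -/
def d5 (t : TO) : Bool := decide (t.2.2.2 = 0)

/-- Test 5 on codes. [folklore] -/
theorem codeFP_d5 : CodeFP toE bitE d5 := natEq.comp (codeFP_θ.pair (const toE 0))

/-- `Δ` on tuples: `⌊√⌊log₂ n⌋⌋`, the logarithm computed with the weight list as budget (so this is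
`sqrtLog n` whenever the weight list has length `n`). [cite: Hirahara2022PartialMCSP, proof of Thm. 8.5 (Δ(n) := (log n)^{1/2})] -/
def ΔT (t : TO) : ℕ := Nat.sqrt (min t.2.2.1.length (Nat.log 2 t.1))

/-- `Δ` on codes. [folklore] -/
theorem codeFP_ΔT : CodeFP toE natE ΔT := by
  have hunits : CodeFP toE (rawE unitE) (fun t => List.replicate t.2.2.1.length ()) :=
    replicateUnit.comp ((ulength unE).comp codeFP_wt)
  exact (natSqrt.comp (natLog2Min.comp (codeFP_n.pair hunits))).congr fun t => by simp [ΔT]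

/-- On a tuple with a weight list of length `n`, `ΔT = sqrtLog n`. [folklore] -/
theorem ΔT_eq (t : TO) (h : t.2.2.1.length = t.1) : ΔT t = sqrtLog t.1 := by
  unfold ΔT; rw [MetaComplexity.sqrtLog, h, min_eq_right]
  exact (Nat.log_le_self 2 _)

/-- Test 6: smallness `Δ < c`. [folklore] -/
def d6 (c : ℕ) (t : TO) : Bool := decide (ΔT t < c)

/-- Test 6 on codes. [folklore] -/
theorem codeFP_d6 (c : ℕ) : CodeFP toE bitE (d6 c) := natLt.comp (codeFP_ΔT.pair (const toE c))

/-- The number of literals of a formula. [folklore] -/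
def numLitT (φ : MonotoneDNF) : ℕ := (φ.map List.length).sum

/-- `numLitT = numLiterals`. [folklore] -/
theorem numLitT_eq (φ : MonotoneDNF) : numLitT φ = φ.numLiterals := rfl

/-- The number of literals on codes (unary). [folklore] -/
theorem codeFP_numLitT : CodeFP fE unE numLitT := (unSum.comp (map₀ (ulength natE))).congr fun _ => rfl

/-- Test 7: some formula has more than `Δ` literals. [folklore] -/
def d7 (t : TO) : Bool := t.2.1.any fun φ => decide (ΔT t < numLitT φ)

/-- Test 7 on codes. [folklore] -/
theorem codeFP_d7 : CodeFP toE bitE d7 :=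
  ((any (σ := TO) (eσ := toE) (natLt.comp ((codeFP_ΔT.comp (fst _ _)).pair (natOfUn.comp (codeFP_numLitT.comp (snd _ _)))))).comp
    ((CodeFP.id toE).pair codeFP_formulasRaw)).congr fun _ => rfl

/-- `a < foldr max 0 l` iff some item exceeds `a`. [folklore] -/
theorem lt_foldr_max_iff (a : ℕ) : ∀ l : List ℕ, a < l.foldr max 0 ↔ ∃ x ∈ l, a < x
  | [] => by simp
  | x :: l => by
    rw [List.foldr_cons, lt_max_iff, lt_foldr_max_iff a l]
    simp

/-- Test 7 decides `Δ < degree` (on tuples with a weight list of length `n`). [folklore] -/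
theorem d7_toTuple (I₀ : CMMSAInstance) (hlen : I₀.weight.length = I₀.numVars) :
    d7 I₀.toTuple = decide (sqrtLog I₀.numVars < I₀.degree) := by
  unfold d7 CMMSAInstance.degree
  rw [ΔT_eq _ hlen]
  simp only [CMMSAInstance.toTuple]
  rw [Bool.eq_iff_iff, List.any_eq_true, decide_eq_true_iff, lt_foldr_max_iff]
  simp [numLitT_eq]

/-! ### Brute force -/

/-- All sublists of a list (as lists, in a fixed order), capped at `K` lists per round. [folklore] -/
def subsetsT (K : ℕ) (l : List ℕ) : List (List ℕ) := l.foldl (fun acc x => (acc ++ acc.map fun S => x :: S).take K) [[]]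

/-- Evaluating a monotone DNF at a list of true variables. [folklore] -/
def evalT (φ : MonotoneDNF) (S : List ℕ) : Bool := φ.any fun term => term.all fun v => decide (v ∈ S)

/-- `evalT` is `MonotoneDNF.eval` at the indicator. [folklore] -/
theorem evalT_eq (φ : MonotoneDNF) (S : List ℕ) : evalT φ S = φ.eval fun v => decide (v ∈ S) := rfl

/-- The brute-force cap `2^{2^{c²}}` (the number of subsets of `[n]` for `n < 2^{c²}`). [folklore] -/
def bruteCap (c : ℕ) : ℕ := 2 ^ 2 ^ (c * c)

/-- **The brute-force test on tuples**: some sublist `S` of `[0, n)` (with `n` read as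
`min |weights| n`) has weight `≤ θ` and satisfies every formula. [cite: Hirahara2022PartialMCSP, proof of Thm. 8.5 (instances of bounded size)] -/
def bruteT (c : ℕ) (t : TO) : Bool :=
  (subsetsT (bruteCap c) (List.range (min t.1 t.2.2.1.length))).any fun S =>
    decide ((S.map (wT t)).sum ≤ t.2.2.2) && t.2.1.all fun φ => evalT φ S

/-- Every produced sublist, reversed, is a sublist of the processed prefix. [folklore] -/
theorem reverse_sublist_of_mem_fold (K : ℕ) : ∀ (l : List ℕ) (acc : List (List ℕ)) (pre : List ℕ),
    (∀ S ∈ acc, S.reverse.Sublist pre) →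
    ∀ S ∈ l.foldl (fun acc x => (acc ++ acc.map fun S => x :: S).take K) acc, S.reverse.Sublist (pre ++ l)
  | [], acc, pre, h, S, hS => by simpa using h S hS
  | x :: l, acc, pre, h, S, hS => by
    rw [List.foldl_cons] at hS
    have h' : ∀ S ∈ ((acc ++ acc.map fun S => x :: S).take K), S.reverse.Sublist (pre ++ [x]) := by
      intro S hS
      have hS' := List.mem_of_mem_take hS
      rcases List.mem_append.1 hS' with h1 | h1
      · exact (h S h1).trans (List.sublist_append_left _ _)
      · obtain ⟨S', hS'acc, rfl⟩ := List.mem_map.1 h1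
        rw [List.reverse_cons]
        exact ((h S' hS'acc).append_right _).trans (by simp)
    have := reverse_sublist_of_mem_fold K l _ (pre ++ [x]) h' S hS
    simpa using this

/-- The subsets fold on codes (cap `K`). [cite: AroraBarak2009, §1.3 (bounded loops)] -/
theorem codeFP_subsetsT (K : ℕ) : CodeFP (rawE natE) (rawE (rawE natE)) (subsetsT K) := by
  have hcons : CodeFP (pairE natE (rawE (rawE natE))) (rawE (rawE natE)) (fun t => t.2.map fun S => t.1 :: S) :=
    map (σ := ℕ) (eσ := natE) (rawCons natE)
  have hstep : CodeFP (pairE natE (rawE (rawE natE))) (rawE (rawE natE))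
      (fun t => (t.2 ++ t.2.map fun S => t.1 :: S).take K) :=
    (rawTakeUn (rawE natE)).comp ((const _ K).pair ((rawAppend (rawE natE)).comp ((snd _ _).pair hcons)))
  have h := foldl₀ (eα := natE) (step := fun x acc => (acc ++ acc.map fun S => x :: S).take K) (b₀ := [[]])
    hstep (C (max K 1) * (2 * X + 2)) (fun l₁ l₂ => by
      set res := l₁.foldl (fun acc x => (acc ++ acc.map fun S => x :: S).take K) [[]] with hres
      -- at most `K` lists (or one, if `K = 0` and `l₁ = []`), each a rearranged sublist of `l₁`
      have hlen : res.length ≤ max K 1 := by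
        rw [hres]
        rcases l₁.eq_nil_or_concat with h0 | ⟨l', x, hl⟩
        · rw [h0]; simp
        · rw [hl, List.concat_eq_append, List.foldl_append, List.foldl_cons, List.foldl_nil]
          exact (List.length_take_le _ _).trans (le_max_left _ _)
      have hitem : ∀ S ∈ res, (rawE natE S).length ≤ (rawE natE (l₁ ++ l₂)).length := by
        intro S hS
        have hsub := reverse_sublist_of_mem_fold K l₁ [[]] [] (by simp) S (by rw [← hres]; exact hS)
        rw [List.nil_append] at hsub
        calc (rawE natE S).length = (rawE natE S.reverse).length := by rw [length_rawE, length_rawE, List.map_reverse, List.sum_reverse]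
          _ ≤ (rawE natE l₁).length := length_rawE_le_of_sublist natE hsub
          _ ≤ (rawE natE (l₁ ++ l₂)).length := length_rawE_le_of_sublist natE (List.sublist_append_left _ _)
      have key : (res.map fun S => 2 * (rawE natE S).length + 2).sum ≤ max K 1 * (2 * (rawE natE (l₁ ++ l₂)).length + 2) :=
        calc (res.map fun S => 2 * (rawE natE S).length + 2).sum
            ≤ (res.map fun S => 2 * (rawE natE S).length + 2).length • (2 * (rawE natE (l₁ ++ l₂)).length + 2) :=
              List.sum_le_card_nsmul _ _ fun y hy => by
                obtain ⟨S, hS, rfl⟩ := List.mem_map.1 hy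
                have := hitem S hS; omega
          _ ≤ max K 1 * (2 * (rawE natE (l₁ ++ l₂)).length + 2) := by
              rw [List.length_map, smul_eq_mul]; exact Nat.mul_le_mul_right _ hlen
      rw [length_rawE]
      simpa only [eval_mul, eval_C, eval_add, eval_ofNat, eval_X] using key)
  exact h.congr fun l => rfl

/-- `evalT` on codes: `(S, φ) ↦ evalT φ S`. [folklore] -/
theorem codeFP_evalT : CodeFP (pairE (rawE natE) fE) bitE (fun q => evalT q.2 q.1) := by
  have hmem : CodeFP (pairE (rawE natE) natE) bitE (fun q => decide (q.2 ∈ q.1)) :=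
    (mem natE_injective).comp ((snd _ _).pair (fst _ _))
  have hterm : CodeFP (pairE (rawE natE) (rawE natE)) bitE (fun q => q.2.all fun v => decide (v ∈ q.1)) :=
    all (σ := List ℕ) (eσ := rawE natE) hmem
  exact (any (σ := List ℕ) (eσ := rawE natE) hterm).congr fun q => rfl

/-- **The brute-force test on codes.** [cite: Hirahara2022PartialMCSP, proof of Thm. 8.5] -/
theorem codeFP_bruteT (c : ℕ) : CodeFP toE bitE (bruteT c) := by
  -- the predicate of a candidate list `S`, context `t`
  have hw : CodeFP (pairE toE (rawE natE)) (rawE unE) (fun p => p.2.map fun v => wT p.1 v) :=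
    map (σ := TO) (eσ := toE) codeFP_wT
  have hsum : CodeFP (pairE toE (rawE natE)) bitE (fun p => decide ((p.2.map fun v => wT p.1 v).sum ≤ p.1.2.2.2)) :=
    unLeNat.comp ((unSum.comp hw).pair (codeFP_θ.comp (fst _ _)))
  have hall : CodeFP (pairE toE (rawE natE)) bitE (fun p => p.1.2.1.all fun φ => evalT φ p.2) :=
    (all (σ := List ℕ) (eσ := rawE natE) codeFP_evalT).comp ((snd _ _).pair (codeFP_formulasRaw.comp (fst _ _)))
  have hP := hsum.and hall
  -- the candidates
  have hrange : CodeFP toE (rawE natE) (fun t => List.range (min t.1 t.2.2.1.length)) :=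
    (rangeOf.comp (((ulength unE).comp codeFP_wt).pair codeFP_n)).congr fun t => rfl
  have hsubs : CodeFP toE (rawE (rawE natE)) (fun t => subsetsT (bruteCap c) (List.range (min t.1 t.2.2.1.length))) :=
    (codeFP_subsetsT _).comp hrange
  exact ((any (σ := TO) (eσ := toE) hP).comp ((CodeFP.id toE).pair hsubs)).congr fun t => rfl

/-! ### The subsets fold enumerates the subsets -/

/-- The uncapped subsets step. [folklore] -/
def subsetsStep (acc : List (List ℕ)) (x : ℕ) : List (List ℕ) := acc ++ acc.map fun S => x :: S

/-- Length of the uncapped fold: doubling. [folklore] -/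
theorem length_foldl_subsetsStep : ∀ (l : List ℕ) (acc : List (List ℕ)),
    (l.foldl subsetsStep acc).length = acc.length * 2 ^ l.length
  | [], acc => by simp
  | x :: l, acc => by
    rw [List.foldl_cons, length_foldl_subsetsStep l]
    simp [subsetsStep, pow_succ]; ring

/-- Below the cap the capped fold is the uncapped fold. [folklore] -/
theorem foldl_cap_eq : ∀ (K : ℕ) (l : List ℕ) (acc : List (List ℕ)), acc.length * 2 ^ l.length ≤ K →
    l.foldl (fun acc x => (acc ++ acc.map fun S => x :: S).take K) acc = l.foldl subsetsStep acc
  | K, [], acc, _ => rfl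
  | K, x :: l, acc, h => by
    rw [List.foldl_cons, List.foldl_cons]
    have hlen : (acc ++ acc.map fun S => x :: S).length ≤ K := by
      simp only [List.length_append, List.length_map]
      calc acc.length + acc.length = acc.length * 2 ^ 1 := by ring
        _ ≤ acc.length * 2 ^ (x :: l).length := Nat.mul_le_mul_left _ (Nat.pow_le_pow_right (by norm_num) (by simp))
        _ ≤ K := h
    rw [List.take_of_length_le hlen]
    refine foldl_cap_eq K l _ ?_
    calc (subsetsStep acc x).length * 2 ^ l.length = acc.length * 2 ^ (x :: l).length := by
          simp [subsetsStep, pow_succ]; ring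
      _ ≤ K := h

/-- **The invariant of the subsets fold**: on a duplicate-free list, the produced lists are
duplicate-free with elements from the processed prefix, and every subset of the prefix is the
element set of a produced list. [folklore] -/
theorem subsets_invariant : ∀ (l pre : List ℕ) (acc : List (List ℕ)), (pre ++ l).Nodup →
    ((∀ S ∈ acc, S.Nodup ∧ S.toFinset ⊆ pre.toFinset) ∧ ∀ F ⊆ pre.toFinset, ∃ S ∈ acc, S.toFinset = F) →
    (∀ S ∈ l.foldl subsetsStep acc, S.Nodup ∧ S.toFinset ⊆ (pre ++ l).toFinset) ∧
      ∀ F ⊆ (pre ++ l).toFinset, ∃ S ∈ l.foldl subsetsStep acc, S.toFinset = F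
  | [], pre, acc, _, h => by simpa using h
  | x :: l, pre, acc, hnd, ⟨h1, h2⟩ => by
    rw [List.foldl_cons]
    have hx : x ∉ pre := by
      intro hx
      rw [List.nodup_append] at hnd
      exact hnd.2.2 x hx x (List.mem_cons_self ..) rfl
    have e : pre ++ x :: l = (pre ++ [x]) ++ l := by simp
    rw [e] at hnd ⊢
    refine subsets_invariant l (pre ++ [x]) (subsetsStep acc x) hnd ⟨?_, ?_⟩
    · intro S hS
      rcases List.mem_append.1 hS with hS | hS
      · obtain ⟨hn, hsub⟩ := h1 S hS
        exact ⟨hn, hsub.trans (by simp [Finset.subset_insert])⟩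
      · obtain ⟨S', hS', rfl⟩ := List.mem_map.1 hS
        obtain ⟨hn, hsub⟩ := h1 S' hS'
        have hxS : x ∉ S' := fun hm => hx (List.mem_toFinset.1 (hsub (List.mem_toFinset.2 hm)))
        refine ⟨List.nodup_cons.2 ⟨hxS, hn⟩, ?_⟩
        rw [List.toFinset_cons, List.toFinset_append]
        exact Finset.insert_subset_iff.2 ⟨by simp, hsub.trans Finset.subset_union_left⟩
    · intro F hF
      rw [List.toFinset_append] at hF
      by_cases hxF : x ∈ F
      · obtain ⟨S, hS, hSF⟩ := h2 (F.erase x) (by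
          intro y hy
          rw [Finset.mem_erase] at hy
          have := hF hy.2
          simp only [Finset.mem_union, List.mem_toFinset, List.mem_singleton] at this
          rcases this with h | h
          · exact List.mem_toFinset.2 h
          · exact absurd h hy.1)
        refine ⟨x :: S, List.mem_append_right _ (List.mem_map.2 ⟨S, hS, rfl⟩), ?_⟩
        rw [List.toFinset_cons, hSF, Finset.insert_erase hxF]
      · obtain ⟨S, hS, hSF⟩ := h2 F (by
          intro y hy
          have := hF hy
          simp only [Finset.mem_union, List.mem_toFinset, List.mem_singleton] at this
          rcases this with h | h
          · exact List.mem_toFinset.2 h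
          · exact absurd (h ▸ hy) hxF)
        exact ⟨S, List.mem_append_left _ hS, hSF⟩

/-- **The subsets of a duplicate-free list**, within the cap. [folklore] -/
theorem subsetsT_spec {K : ℕ} {l : List ℕ} (hl : l.Nodup) (hK : 2 ^ l.length ≤ K) :
    (∀ S ∈ subsetsT K l, S.Nodup ∧ S.toFinset ⊆ l.toFinset) ∧ ∀ F ⊆ l.toFinset, ∃ S ∈ subsetsT K l, S.toFinset = F := by
  unfold subsetsT
  rw [foldl_cap_eq K l [[]] (by simpa using hK)]
  have := subsets_invariant l [] [[]] (by simpa using hl)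
    ⟨by simp, fun F hF => ⟨[], by simp, by simp only [List.toFinset_nil] at hF ⊢; exact (Finset.subset_empty.1 hF).symm⟩⟩
  simpa using this

/-! ### Agreement with the specification -/

/-- `sqrtLog n < c` bounds `n < 2^{c²}`. [folklore] -/
theorem lt_two_pow_of_sqrtLog_lt {n c : ℕ} (h : sqrtLog n < c) : n < 2 ^ (c * c) := by
  unfold MetaComplexity.sqrtLog at h
  rw [Nat.sqrt_lt] at h
  exact Nat.lt_pow_of_log_lt (by norm_num) h

/-- **The brute-force test agrees with `bruteYes`** on instance tuples with a weight list of
length `n` and `sqrtLog n < c`. [folklore] -/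
theorem bruteT_toTuple (c : ℕ) (I₀ : CMMSAInstance) (hlen : I₀.weight.length = I₀.numVars) (hsmall : sqrtLog I₀.numVars < c) :
    bruteT c I₀.toTuple = HiraharaRed.bruteYes I₀ := by
  have hn : min I₀.numVars I₀.weight.length = I₀.numVars := by rw [hlen, min_self]
  have hK : 2 ^ (List.range I₀.numVars).length ≤ bruteCap c := by
    rw [List.length_range]; exact Nat.pow_le_pow_right (by norm_num) (lt_two_pow_of_sqrtLog_lt hsmall).le
  obtain ⟨hprod, hcov⟩ := subsetsT_spec (List.nodup_range) hK
  have hrange : (List.range I₀.numVars).toFinset = Finset.range I₀.numVars := by ext; simp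
  rw [hrange] at hprod hcov
  have hsumF : ∀ S : List ℕ, S.Nodup → (S.map (I₀.w ·)).sum = ∑ i ∈ S.toFinset, I₀.w i := fun S hS => (List.sum_toFinset _ hS).symm
  have hevalF : ∀ (S : List ℕ) (φ : MonotoneDNF), evalT φ S = φ.eval fun v => decide (v ∈ S.toFinset) := by
    intro S φ; rw [evalT_eq]; congr 1; funext v; simp
  rw [Bool.eq_iff_iff]
  unfold bruteT HiraharaRed.bruteYes
  simp only [CMMSAInstance.toTuple, hn, List.any_eq_true, Bool.and_eq_true, decide_eq_true_eq, List.all_eq_true]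
  have hwT : wT (I₀.numVars, I₀.formulas, I₀.weight, I₀.threshold) = fun x => I₀.w x := rfl
  rw [hwT]
  constructor
  · rintro ⟨S, hS, hw, hsat⟩
    obtain ⟨hnd, hsub⟩ := hprod S hS
    refine ⟨S.toFinset, Finset.mem_powerset.2 (by simpa using hsub), ?_, fun φ hφ => ?_⟩
    · rw [← hsumF S hnd]; exact hw
    · rw [← hevalF]; exact hsat φ hφ
  · rintro ⟨F, hF, hw, hsat⟩
    obtain ⟨S, hS, rfl⟩ := hcov F (by simpa using Finset.mem_powerset.1 hF)
    obtain ⟨hnd, -⟩ := hprod S hS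
    refine ⟨S, hS, ?_, fun φ hφ => ?_⟩
    · rw [hsumF S hnd]; exact hw
    · rw [hevalF]; exact hsat φ hφ

end HiraharaMachine

end Literature.Computability.Complexity
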